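import Summits.CriticalPhenomena.PercolationContinuityZ3.Theorems.PercNearOneGluingNoHeavyLowerTailCSHLemmaT
import Summits.CriticalPhenomena.PercolationContinuityZ3.Theorems.PercNearOneGluingNoHeavyLowerTailCSHUnfoldMain
import Summits.CriticalPhenomena.PercolationContinuityZ3.Theorems.PercNearOneGluingAdditiveGluingCSHHtwBridge
import Summits.CriticalPhenomena.PercolationContinuityZ3.Theorems.PercNearOneGluingNoHeavyLowerTailCSHToS5
import HarnessLib

/-!
# Crux `PercNearOneGluing.AdditiveGluing` (stmt-CriticalPhenomena-4576): a SECOND in-tree proof of memo THEOREM 1 (the conditioned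
# slack hierarchy) whose level zero does NOT pass through MDL(X) / the hull-port `T_A` chain

Support file (`--supports stmt-CriticalPhenomena-4576`, lead-of-record prim-png-lead-4576 gen 17).  No definitions, no named facts, no
sorries; standard axioms.  The crux is closed (`AdditiveGluing_proof` := `CSH.additiveGluing_holds`, p205530/p205010); this file answers a
minimal-cone question of the post-continuity programme (postcont/FK-PLAN.md §17.1, postcont-2 USES §17 E54 (d)) WITH A KERNEL-CHECKED TERM.

In the landed assembly `CSH.cshHolds` (`…NoHeavyLowerTailCSHTheoremOne.lean`) the induction skeleton `CSH.cshMargin_nonneg_of_unfold`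
(`…AdditiveGluingCSHInduction.lean`) treats the EMPTY decoy list by `CSH.cshMargin_nil_nonneg`, i.e. by prim-hp-7's MDL(X)
`CovTau.markerDominanceAvoid`, which is proved through the hull-port chain `markerDominanceAvoid_of_TA ← TA_of_PvI ← PvI_of_CE ← CE_holds`
(`…NoHeavyLowerTailCovTauOfTA.lean` and the `…HullPortTA*` files).  But none of the three lemmas of the step — Lemma T
`CSH.cshMargin_nonneg_of_within` (hypotheses `hY`, `hW` only), Lemma U `CSH.within_nonneg_of_hpart` (at `D = []` its lower-level hypothesis
`hIH` is vacuous) and Lemma H `CSH.hpart_nonneg` (marker set `S = {x}` allowed) — needs `D ≠ []`.  Hence the strong induction on the number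
of decoys runs UNIFORMLY, with no separate base case: level zero is Lemma T(`[]`) ∘ Lemma U(`[]`) ∘ Lemma H(`{x}`), the bond twin of the site
chain's `SiteCSH.cshMargin_nil_nonneg_of_lemmaT`.  As a by-product the hypotheses `x ∉ Y`, `o ∉ {x} ∪ Y`, `o ≠ v` of `CSH.cshHolds` are
not needed for THEOREM 1 (they were only threaded to the unused binders of `hU`).

* `CSH.cshMargin_nonneg_of_lower_induction` — THEOREM 1 by the uniform strong induction (step = Lemma T, then Lemma U + Lemma H at the
  marker set `{x} ∪ D`, lower levels by the induction hypothesis; the skeleton's `hU` is never stated, so no `D ≠ []` arises); its case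
  `D = []` is the statement of `CSH.cshMargin_nil_nonneg` (level zero = MDL(X) divided by `μ(v ↮ {x} ∪ Y)`), re-proved;
* `CSH.cshHolds_of_hpart` — `CSH.CSHHolds w x Y D o v` under the hypotheses actually used;
* a closing `example : PercNearOneGluing.AdditiveGluing` — the crux again (`CSH.additiveGluing_of_csh` ∘ `CSH.cshHolds_of_hpart`; the named
  statements `CSH.additiveGluing_holds` / `CSH.cshAll` / `CSH.cshMargin_nil_nonneg` are already landed and are not re-declared here).
CONES (measured at landing time).  Modules: the import cone of this file omits `…CovTauOfTA`, `…CovTauConsequences`, `…CovTauTransfer`,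
`…HullPortTACE`, `…MarkerDominancePv`, `…SurplusTransferPair{,OfCov,Tools}`, `Literature…ClusterConditionalCovariance`,
`Literature…TargetExplorationSwap` (and `…CSHInduction` / `…CSHTheoremOne` themselves): 12 modules, 3,591 lines of the cone of
`CSH.additiveGluing_holds`; the other `…HullPortTA*` modules stay as tool imports of `…CSHUnfold*`.  Declarations (DFS over used constants,
project namespaces only): the cone of `CSH.additiveGluing_holds` has 1,171 project constants (653 `Summit`, 518 `Literature`), 142 of them
`HullPort.*`, including `CovTau.markerDominanceAvoid`, `HullPort.CE_holds`, `HullPort.PvI_of_CE`, `HullPort.TA_of_PvI`,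
`HullPort.taQ_nonneg_of_PvI`; the cone of the closing `example`'s term (measured as a named theorem in a scratch file) has 957 (518 `Summit`, 439 `Literature`),
NONE of those five, and only 12 `HullPort.*` constants, all bookkeeping (`HullPort.cut`, `cut_eq_barOf`, `avoidEv`, `set_sum_cond_sdiff`,
`reachable_empty_iff`, `reachable_iff_setCl_singleton`, `reachable_sdiff_cut_singleton_iff`, `openEdgeCluster_sdiff_cut_singleton`,
`eq_of_reachable_of_isolated` + 3 `simp` auxiliaries).  Both proofs share Lemma T, Lemma U, Lemma H (`CSH.htw_world` ← prim-hp-4's AD star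
step `CovTau.metaA2_of_star`) and hp-8's peeling `CSH.additiveGluing_of_csh`.
[cite: VandenbergHaggstromKahn2005, §2.1 (pp. 9–13), Thm. 1.4 (p. 7)] [cite: KozmaNitzan2024, Conj. 1 (p. 3), Conj. 4 (p. 32)] [cite: Gladkov2024, Thm. 3.2]
-/

noncomputable section

namespace Summit.CriticalPhenomena.PercolationContinuityZ3.Theorems

open MeasureTheory Set Literature.Probability.LatticeModels Literature.Probability.Percolation
open scoped Classical
open Summit.CriticalPhenomena.PercolationContinuityZ3.Theses

namespace CSH

variable {V : Type*} [Fintype V]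

/-- **MEMO THEOREM 1 by the UNIFORM strong induction on the number of decoys** (no separate base case): for non-degenerate weights,
`v ∉ {x} ∪ Y` and distinct decoys off `{x} ∪ Y ∪ {o, v}`, `0 ≤ CSH.cshMargin w x Y D o v f` for every decoy list `D` (the empty one
included) and every monotone `f`.  The step, from all strictly shorter lists to `D`: Lemma T `CSH.cshMargin_nonneg_of_within` reduces to
the world-wise margin; Lemma U `CSH.within_nonneg_of_hpart` splits it into the H-part at the marker set `{x} ∪ D` — nonnegative by Lemma H
`CSH.hpart_nonneg` (for `D = []` the marker set is `{x}`) — plus the lower-level margins along the splittings `D = pre ++ d :: ds'`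
(owner `d`, avoided set `{x} ∪ Y ∪ pre`, decoys `ds'`, fewer decoys: the induction hypothesis; vacuous for `D = []`).
[cite: VandenbergHaggstromKahn2005, §2.1 (pp. 9–13), Thm. 1.4 (p. 7)] [cite: KozmaNitzan2024, Conj. 4 (p. 32)] [cite: Gladkov2024, Thm. 3.2] -/
theorem cshMargin_nonneg_of_lower_induction (w : Sym2 V → unitInterval) (hw : ∀ e, 0 < w e ∧ w e < 1) :
    ∀ (D : List V) (x : V) (Y : Set V) (o v : V),
      v ∉ insert x Y → D.Nodup → (∀ d ∈ D, d ∉ insert x Y ∧ d ≠ o ∧ d ≠ v) →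
      ∀ f : Set (Sym2 V) → ℝ, Monotone f → 0 ≤ cshMargin w x Y D o v f := by
  have hY : ∀ (Y : Set V) (e : Sym2 V), ¬ e.IsDiag → (∃ u ∈ e, u ∈ Y) → (w e : ℝ) < 1 :=
    fun _ e _ _ => unitInterval.coe_lt_one.2 (hw e).2
  -- THE UNIFORM STEP: from all strictly shorter decoy lists (any owner / avoided set, same observers) to `D`
  have step : ∀ (D : List V) (x : V) (Y : Set V) (o v : V),
      v ∉ insert x Y → D.Nodup → (∀ d ∈ D, d ∉ insert x Y ∧ d ≠ o ∧ d ≠ v) →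
      (∀ (D' : List V) (x' : V) (Y' : Set V), D'.length < D.length → v ∉ insert x' Y' → D'.Nodup →
        (∀ d ∈ D', d ∉ insert x' Y' ∧ d ≠ o ∧ d ≠ v) → ∀ h : Set (Sym2 V) → ℝ, Monotone h → 0 ≤ cshMargin w x' Y' D' o v h) →
      ∀ f : Set (Sym2 V) → ℝ, Monotone f → 0 ≤ cshMargin w x Y D o v f := by
    intro D x Y o v hv hnd hdis ih f hf
    -- Lemma T: reduce to the world-wise margin
    refine cshMargin_nonneg_of_within w x Y D o v (hY Y) (fun g hg hg0 => ?_) f hf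
    -- Lemma U: H-part + lower levels
    have hD' : ∀ d ∈ D, d ≠ x ∧ d ∉ Y ∧ d ≠ o ∧ d ≠ v := fun d hd => by
      obtain ⟨h1, h2, h3⟩ := hdis d hd
      rw [mem_insert_iff, not_or] at h1
      exact ⟨h1.1, h1.2, h2, h3⟩
    refine within_nonneg_of_hpart w hw x Y D o v hnd hD' hg (fun pre d ds' hsplit h hh _ => ?_) ?_
    · -- the lower level `(d | {x} ∪ Y ∪ pre ; ds')` has fewer decoys: induction hypothesis
      have hlen : ds'.length < D.length := by
        have : D.length = pre.length + (ds'.length + 1) := by rw [hsplit, List.length_append, List.length_cons]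
        omega
      have hdD : d ∈ D := by rw [hsplit]; exact List.mem_append_right pre List.mem_cons_self
      have hpreD : ∀ e ∈ pre, e ∈ D := fun e he => by rw [hsplit]; exact List.mem_append_left _ he
      have hds'D : ∀ e ∈ ds', e ∈ D := fun e he => by
        rw [hsplit]; exact List.mem_append_right pre (List.mem_cons_of_mem d he)
      -- nodup bookkeeping along `pre ++ d :: ds'`
      have hnd' : (pre ++ d :: ds').Nodup := hsplit ▸ hnd
      have hnd_ds' : ds'.Nodup := (List.nodup_cons.1 (List.nodup_append.1 hnd').2.1).2
      have hd_notin_ds' : d ∉ ds' := (List.nodup_cons.1 (List.nodup_append.1 hnd').2.1).1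
      have hds'_notin_pre : ∀ e ∈ ds', e ∉ pre := fun e he hep =>
        (List.nodup_append.1 hnd').2.2 e hep e (List.mem_cons_of_mem d he) rfl
      -- the new avoided set
      set Y' : Set V := insert x Y ∪ {e | e ∈ pre} with hY'
      have hvY' : v ∉ insert d Y' := by
        rintro (h0 | h1 | h2)
        · exact (hdis d hdD).2.2 h0.symm
        · exact hv h1
        · exact (hdis v (hpreD v h2)).2.2 rfl
      have hdis' : ∀ e ∈ ds', e ∉ insert d Y' ∧ e ≠ o ∧ e ≠ v := by
        intro e he
        refine ⟨?_, (hdis e (hds'D e he)).2.1, (hdis e (hds'D e he)).2.2⟩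
        rintro (h0 | h1 | h2)
        · exact hd_notin_ds' (h0 ▸ he)
        · exact (hdis e (hds'D e he)).1 h1
        · exact hds'_notin_pre e he h2
      exact ih ds' d Y' hlen hvY' hnd_ds' hdis' h hh
    · -- Lemma H at the marker set `{x} ∪ D`
      have hv' : v ≠ x ∧ v ∉ Y := by rwa [mem_insert_iff, not_or] at hv
      have hvS : v ∉ insert x D.toFinset := by
        rw [Finset.mem_insert, List.mem_toFinset, not_or]
        exact ⟨hv'.1, fun h => (hdis v h).2.2 rfl⟩
      have hS : ((↑(insert x D.toFinset) : Set V) ∪ Y) = insert x Y ∪ {d | d ∈ D} := by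
        ext u
        simp only [Finset.coe_insert, mem_union, mem_insert_iff, Finset.mem_coe, List.mem_toFinset, mem_setOf_eq]
        tauto
      have key := hpart_nonneg w hw x Y (insert x D.toFinset) (Finset.mem_insert_self x _) o v hvS hv'.2 g hg hg0
      rw [hS] at key
      -- the two statements agree up to the (subsingleton) decidability instances inside the world weights
      convert key using 20
  -- strong induction on the length of the decoy list
  suffices hk : ∀ (k : ℕ) (D : List V), D.length ≤ k → ∀ (x : V) (Y : Set V) (o v : V),
      v ∉ insert x Y → D.Nodup → (∀ d ∈ D, d ∉ insert x Y ∧ d ≠ o ∧ d ≠ v) →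
      ∀ f : Set (Sym2 V) → ℝ, Monotone f → 0 ≤ cshMargin w x Y D o v f from
    fun D => hk D.length D le_rfl
  intro k
  induction k with
  | zero =>
    intro D hD x Y o v hv hnd hdis f hf
    exact step D x Y o v hv hnd hdis (fun D' _ _ hlt => absurd (lt_of_lt_of_le hlt hD) (Nat.not_lt_zero _)) f hf
  | succ k ih =>
    intro D hD x Y o v hv hnd hdis f hf
    exact step D x Y o v hv hnd hdis
      (fun D' x' Y' hlt hv' hnd' hdis' h hh => ih D' (by omega) x' Y' o v hv' hnd' hdis' h hh) f hf

/-- **MEMO THEOREM 1 (`CSH.CSHHolds`), second proof**, under the hypotheses the proof actually uses: non-degenerate weights,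
`v ∉ {x} ∪ Y`, distinct decoys off `{x} ∪ Y ∪ {o, v}` (the hypotheses `x ∉ Y`, `o ∉ {x} ∪ Y`, `o ≠ v` of `CSH.cshHolds` are not needed).
[cite: VandenbergHaggstromKahn2005, §2.1 (pp. 9–13)] [cite: KozmaNitzan2024, Conj. 4 (p. 32)] -/
theorem cshHolds_of_hpart (w : Sym2 V → unitInterval) (hw : ∀ e, 0 < w e ∧ w e < 1) (x : V) (Y : Set V) (D : List V) (o v : V)
    (hv : v ∉ insert x Y) (hnd : D.Nodup) (hdis : ∀ d ∈ D, d ∉ insert x Y ∧ d ≠ o ∧ d ≠ v) : CSHHolds w x Y D o v :=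
  fun f hf => cshMargin_nonneg_of_lower_induction w hw D x Y o v hv hnd hdis f hf

/-- **The crux `AdditiveGluing` (stmt-CriticalPhenomena-4576) again**, through the second proof of THEOREM 1 fed to hp-8's peeling
`CSH.additiveGluing_of_csh` (an `example`, not a named theorem: the statement is `CSH.additiveGluing_holds`, already landed; the point is
the kernel check of THIS term, whose declaration cone avoids MDL(X) and the hull-port `T_A` chain). [cite: KozmaNitzan2024, Conj. 1 (p. 3)] -/
example : PercNearOneGluing.AdditiveGluing := by
  refine additiveGluing_of_csh fun n w hw o v x Y D _ _ _ hvx _ hvY hD hdis => ?_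
  refine cshHolds_of_hpart w hw x (↑Y : Set (Fin n)) D o v ?_ hD ?_
  · simp only [mem_insert_iff, Finset.mem_coe, not_or]; exact ⟨hvx, hvY⟩
  · intro d hd
    obtain ⟨h1, h2, h3, h4⟩ := hdis d hd
    exact ⟨by simp only [mem_insert_iff, Finset.mem_coe, not_or]; exact ⟨h1, h2⟩, h3, h4⟩

end CSH

end Summit.CriticalPhenomena.PercolationContinuityZ3.Theorems

end
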